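import Summits.AtomisticToContinuum.Crystallization.Theorems.ChessboardParticlePlanesPeriodicWindowsOffsetLayerSymmetry

/-!
# Crux `PeriodicWindows` (stmt-AtomisticToContinuum-3240), line `dense-laminar-hull` — further symmetries of the
# general-offset layer interaction (stub `hc_layerSum_symm` of the hollow closing HC; lead c12)

The interaction of a point with a full triangular layer at height `H` and horizontal offset `θ`,
`Φ(a, H, θ) = Σ'_{(i,j) ∈ ℤ²} V ‖i v₁(a) + j v₂(a) + θ + H e₃‖` (written inline; no definition is introduced), satisfies,
for every potential `V` and every HORIZONTAL offset `θ` (`θ 2 = 0`), without any summability: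

* `Φ(a, -H, θ) = Φ(a, H, θ)` — termwise, by Pythagoras `‖w + t e₃‖² = ‖w‖² + t²` for the horizontal `w = i v₁ + j v₂ + θ`;
* `Φ(a, H, -θ) = Φ(a, H, θ)` — re-index by `(i, j) ↦ (-i, -j)` and use `‖-x‖ = ‖x‖` together with the first symmetry;
* `Φ(a, H, T θ) = Φ(a, H, θ)` for every norm-preserving additive homogeneous map `T` with `T v₁ = v₂ - v₁`, `T v₂ = -v₁`,
  `T e₃ = e₃` (the rotation by `2π/3` about the ATOP site) — re-index by `(i, j) ↦ (-i-j, i)`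
  (`T (i v₁ + j v₂) = (-i-j) v₁ + i v₂`), exactly as in `gs_offsetLayer_rotate_hollow`.

All three are `tsum_congr` / `Equiv.tsum_eq`. [folklore]
-/

noncomputable section

namespace Summit.AtomisticToContinuum.Crystallization.Theorems.PeriodicWindowsDenseLaminarHull

open Literature.MathematicalPhysics.StatisticalMechanics Filter Metric
open scoped BigOperators

/-- A layer-lattice point shifted by a horizontal offset is horizontal: its third coordinate vanishes. [folklore] -/
theorem hcs_horiz_two (a : ℝ) (θ : EuclideanSpace ℝ (Fin 3)) (hθ : θ 2 = 0) (i j : ℝ) :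
    (i • triangularVec₁ a + j • triangularVec₂ a + θ) 2 = 0 := by
  simp only [PiLp.add_apply, PiLp.smul_apply, hθ, gsc_triangularVec₁_two, gsc_triangularVec₂_two, smul_eq_mul, mul_zero,
    add_zero]

/-- Reflection in the layer plane preserves distances to horizontal vectors: `‖h + (-t) e₃‖ = ‖h + t e₃‖` for
horizontal `h`. [folklore] -/
theorem hcs_norm_horiz_negH (h : EuclideanSpace ℝ (Fin 3)) (hh : h 2 = 0) (t : ℝ) :
    ‖h + (-t) • layerNormal 1‖ = ‖h + t • layerNormal 1‖ := by
  have h1 := gsc_norm_sq_horiz_add h hh (-t)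
  rw [neg_sq, ← gsc_norm_sq_horiz_add h hh t] at h1
  exact (pow_left_inj₀ (norm_nonneg _) (norm_nonneg _) two_ne_zero).1 h1

/-- **Symmetries of the general-offset layer interaction** `Φ(a, H, θ) = Σ'_{(i,j) ∈ ℤ²} V ‖i v₁ + j v₂ + θ + H e₃‖`
for a horizontal offset `θ` and an arbitrary potential `V` (no summability needed):
`H ↦ -H` (termwise), `θ ↦ -θ` (re-index `(i, j) ↦ (-i, -j)`), and `θ ↦ T θ` for the abstract rotation by `2π/3`
about the atop site (`T v₁ = v₂ - v₁`, `T v₂ = -v₁`, `T e₃ = e₃`, `‖T ·‖ = ‖·‖`; re-index `(i, j) ↦ (-i-j, i)`).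
[folklore] -/
theorem hc_layerSum_symm : ∀ (V : ℝ → ℝ) (a H : ℝ) (θ : EuclideanSpace ℝ (Fin 3)), θ 2 = 0 →
    (∑' ij : ℤ × ℤ, V ‖((ij.1 : ℝ)) • triangularVec₁ a + ((ij.2 : ℝ)) • triangularVec₂ a + θ + (-H) • layerNormal 1‖) =
      (∑' ij : ℤ × ℤ, V ‖((ij.1 : ℝ)) • triangularVec₁ a + ((ij.2 : ℝ)) • triangularVec₂ a + θ + H • layerNormal 1‖) ∧
    (∑' ij : ℤ × ℤ, V ‖((ij.1 : ℝ)) • triangularVec₁ a + ((ij.2 : ℝ)) • triangularVec₂ a + (-θ) + H • layerNormal 1‖) =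
      (∑' ij : ℤ × ℤ, V ‖((ij.1 : ℝ)) • triangularVec₁ a + ((ij.2 : ℝ)) • triangularVec₂ a + θ + H • layerNormal 1‖) ∧
    ∀ (T : EuclideanSpace ℝ (Fin 3) →+ EuclideanSpace ℝ (Fin 3)), (∀ w, ‖T w‖ = ‖w‖) →
      T (triangularVec₁ a) = triangularVec₂ a - triangularVec₁ a → T (triangularVec₂ a) = -triangularVec₁ a →
      T (layerNormal 1) = layerNormal 1 → (∀ (c : ℝ) (w : EuclideanSpace ℝ (Fin 3)), T (c • w) = c • T w) →
      (∑' ij : ℤ × ℤ, V ‖((ij.1 : ℝ)) • triangularVec₁ a + ((ij.2 : ℝ)) • triangularVec₂ a + T θ + H • layerNormal 1‖) =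
        ∑' ij : ℤ × ℤ, V ‖((ij.1 : ℝ)) • triangularVec₁ a + ((ij.2 : ℝ)) • triangularVec₂ a + θ + H • layerNormal 1‖ := by
  intro V a H θ hθ
  refine ⟨?_, ?_, ?_⟩
  · -- `H ↦ -H`: termwise, the lattice point plus the offset is horizontal
    exact tsum_congr fun ij => by rw [hcs_norm_horiz_negH _ (hcs_horiz_two a θ hθ _ _) H]
  · -- `θ ↦ -θ`: re-index by `(i, j) ↦ (-i, -j)`, then `‖-x‖ = ‖x‖` and the first symmetry
    rw [← Equiv.tsum_eq (Equiv.neg (ℤ × ℤ))]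
    refine tsum_congr fun ij => ?_
    obtain ⟨i, j⟩ := ij
    simp only [Equiv.neg_apply, Prod.neg_mk, Int.cast_neg]
    have hv : (-(i : ℝ)) • triangularVec₁ a + (-(j : ℝ)) • triangularVec₂ a + -θ + H • layerNormal 1 =
        -(((i : ℝ)) • triangularVec₁ a + ((j : ℝ)) • triangularVec₂ a + θ + (-H) • layerNormal 1) := by
      module
    rw [hv, norm_neg, hcs_norm_horiz_negH _ (hcs_horiz_two a θ hθ _ _) H]
  · -- `θ ↦ T θ`: re-index by `(i, j) ↦ (-i-j, i)` with inverse `(i, j) ↦ (j, -i-j)`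
    intro T hT hTu hTv hTe hTs
    set e : ℤ × ℤ ≃ ℤ × ℤ := ⟨fun ij => (-ij.1 - ij.2, ij.1), fun ij => (ij.2, -ij.1 - ij.2),
      fun ij => Prod.ext (by simp) (by simp only; ring), fun ij => Prod.ext (by simp only; ring) (by simp)⟩ with he
    rw [← Equiv.tsum_eq e]
    refine tsum_congr fun ij => ?_
    obtain ⟨i, j⟩ := ij
    simp only [he, Equiv.coe_fn_mk, Int.cast_sub, Int.cast_neg]
    -- key identity: the re-indexed vector is `T` of the original one; `T` preserves norms
    have key : T (((i : ℝ)) • triangularVec₁ a + ((j : ℝ)) • triangularVec₂ a + θ + H • layerNormal 1) =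
        (-(i : ℝ) - j) • triangularVec₁ a + ((i : ℝ)) • triangularVec₂ a + T θ + H • layerNormal 1 := by
      simp only [map_add, hTs, hTu, hTv, hTe, smul_sub]
      module
    rw [← key, hT]

end Summit.AtomisticToContinuum.Crystallization.Theorems.PeriodicWindowsDenseLaminarHull

end
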